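import Summits.QuantumFields.BalabanUV.Beta.EriceRemainderEnclosureHistoryAutonomyComparisonAgeCompositionRowCertificate
import Literature.NumberTheory.Sieve.AsymptoticSieveForPrimesDecompositionProofs

/-!
# EriceRemainderEnclosureHistoryAutonomyComparisonAgeCompositionGeometricCover — (E114c) THE GEOMETRIC COVER: POSITIVITY OF A TRIANGULAR RENEWAL SYSTEM FROM A
# UNIFORM LOWER BOUND ON THE DEEPER ROWS — interpolating EXACTLY between the light-load criterion (rows of mass `≤ 1`, (E71a)∕(E86i)) and the stationary
# difference trick (rows dominated by the deeper rows, ANY mass, (E113a) `sol_nonneg_le_of_row_shift`).  In (E113a)'s language (`t n = w n − R t n`,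
# `R v n = Σ_{l<N} K n l·v(n+1+l)`, `K ≥ 0`, `w ≥ 0` non-increasing, zero tail): (§1) a cover may be checked ENTRYWISE — `K n l ≤ λ_n(l) + Σ_{j<l} λ_n(j)·K (n+1+j) (l−1−j)`
# (the entry of the deeper equation `n+1+j` at the same absolute column) implies (E113a)'s functional cover (**`cover_of_entrywise`**, one exchange of a
# triangular double sum); (§2) if the deeper rows dominate the row up to a factor `r ∈ ]0,1]` at every common column, `r·K n l ≤ K (n+1+j) (l−1−j)` (`j < l`), then
# the GEOMETRIC (greedy) weights `λ_n(l) = K n l·Π_{i<l}(1 − r·K n i)` cover row `n` EXACTLY (`λ_n(l) + r·K n l·Σ_{j<l}λ_n(j) = K n l`, **`geom_weights_cover`**) with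
# total mass `Σ_{l<N} λ_n(l) = (1 − Π_{l<N}(1 − r·K n l))∕r` (**`geom_weights_sum`**); hence **`sol_nonneg_le_of_geometric_cover`**: `0 ≤ t ≤ w` as soon as
#     `Π_{l<N} (1 − r·K n l) ≥ 1 − r`   at every pin
# (and `r·K n l ≤ 1`).  READING: `r → 0⁺` is the light load (`(1 − Π)∕r → Σ_l K n l ≤ 1`); `r = 1` asks NOTHING of the masses (`Π ≥ 0`: **`sol_nonneg_le_of_deeper_domination`**);
# in between, `Π(1 − x_l) ≥ exp(−Σ_l x_l∕(1 − x_l))` (**`exp_neg_sum_le_prod_one_sub`**) gives the criterion `Σ_l r·K n l∕(1 − r·K n l) ≤ log(1∕(1−r))`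
# (**`sol_nonneg_le_of_geometric_cover_exp`**) — for rows with small entries, mass up to `≈ log(1∕(1−r))∕r` (= 1.234 at `r = 2^{−3∕2}`, the concavity bound of an
# UNDAMPED admissible flow: `a_{n+k+d} ≤ 2a_{n+k}` for `d < k`, README `HOME/b2b-balaban-beta-d4-p2/g95/README.md` §2 (d), §6 (1)), against `1` for the light load.
# The flow-level instance (the first certificate beyond mass one for old-dominated profiles, and its depth-dependent sharpening `r(d,l) = (l∕(l+d))^{3∕2} → 1` on old
# columns — the road to a mass-INDEPENDENT cover of the old part) is the successor's item (1); numerically the LP-OPTIMAL cover of (E113a) has mass ≈ 0.55–0.6 on the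
# old-only maximisers where the next-row certificate reaches 1 (README g95 §5).

Cell `pub-balaban`, β-function sub-cell, BINDER row D4 «RemainderConst leaves for Bałaban's split» (`HOME/BINDER-OWNERS.md`; owner lineage `b2b-balaban-beta-an4`;
this file by co-owner #2 lineage `b2b-balaban-beta-d4-p2`, generation 95), β-FLOW TEAM duty (1), FREEZE (0) honoured (def-free; imports (E113a) and
`Literature.NumberTheory.Sieve.AsymptoticSieveForPrimesDecompositionProofs` for the elementary `exp_neg_div_le_one_sub`; uses (E113a) `sol_nonneg_le_of_cover` BY NAME;
abstract renewal language, no flows).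

HONEST FRAMING (page 1, verbatim and binding).  *"Discharging BetaPertH makes Bałaban's UV stability UNCONDITIONAL — a real constructive-QFT result; it is
NOT the continuum limit and NOT the Clay problem."*  THIS FILE DISCHARGES NOTHING OF THE KIND.  Elementary linear algebra ∕ real analysis about ABSTRACT
triangular systems — hypotheses of a census, not facts; the form, signs, ages and moments of Bałaban's (1.22) limit functional are NOT PRINTED ([I] p. 298;
GAPS G-t4-U2-1∕-2) and NOT asserted.  Row D4 class UNCHANGED (critical-path width 0; instance 0∕1; D4 DISCHARGE NO DATE).  HONEST DEPENDENCY: continuum YM on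
T⁴ ⇐ BetaPertH ∧ nine spine estimates (0/9 proved); BetaPertH ⇐ (D1) ∧ (D4) ∧ CAP+tail; G-an2-4 gates asym, D1 and NE2/3/4.

PRESEARCH.  Product-form (geometric) supersolutions for renewal ∕ Volterra difference inequalities are classical in spirit (Feller XIII; discrete Gronwall lemmas);
this cover form for the census's non-stationary systems is located in no source — [folklore].  NOT CLAIMED: any statement about flows (successor); anything printed —
NOT B12 Thm 2, NOT BetaPertH.

WHAT IS PROVED ([folklore]; 0 `def`, 0 sorry).  §1 **`cover_of_entrywise`**.  §2 `geom_weights_sum`, **`geom_weights_cover`**, **`sol_nonneg_le_of_geometric_cover`**,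
`sol_nonneg_le_of_deeper_domination`.  §3 `one_sub_sum_le_prod_one_sub`, **`exp_neg_sum_le_prod_one_sub`** (the termwise `exp(−x∕(1−x)) ≤ 1 − x` is
`Literature.NumberTheory.Sieve.exp_neg_div_le_one_sub`, imported — the gate's dedup named it), **`sol_nonneg_le_of_geometric_cover_exp`**.
-/
noncomputable section
open Finset

namespace Summit.QuantumFields.BalabanUV.Beta.EriceRemainderEnclosureHistoryAutonomyComparisonAgeCompositionGeometricCover

open Summit.QuantumFields.BalabanUV.Beta.EriceRemainderEnclosureHistoryAutonomyComparisonAgeCompositionRowCertificate (sol_nonneg_le_of_cover)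

variable {N : ℕ} {K : ℕ → ℕ → ℝ} {R : (ℕ → ℝ) → ℕ → ℝ}

/-! ## §1 Entrywise covers are covers -/

/-- **AN ENTRYWISE COVER IS A COVER.**  Kernel `K ≥ 0`, reads `R v n = Σ_{l<N} K n l·v(n+1+l)`, weights `λ ≥ 0`.  If at every pin and every lag `l < N`
`K n l ≤ λ n l + Σ_{j<l} λ n j·K (n+1+j) (l−1−j)` (the deeper equation `n+1+j` reads the absolute column `n+1+l` at its lag `l−1−j`), then for every `v ≥ 0` below the
pin `R v n ≤ Σ_{j<N} λ n j·(v(n+1+j) + R v (n+1+j))` — the hypothesis of (E113a) `sol_nonneg_le_of_cover`. [folklore] -/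
theorem cover_of_entrywise (hR : ∀ v n, R v n = ∑ l ∈ range N, K n l * v (n + 1 + l)) (hK : ∀ n l, 0 ≤ K n l)
    {lam : ℕ → ℕ → ℝ} (hlam0 : ∀ n j, 0 ≤ lam n j)
    (hent : ∀ n l, l < N → K n l ≤ lam n l + ∑ j ∈ range l, lam n j * K (n + 1 + j) (l - 1 - j))
    (n : ℕ) (v : ℕ → ℝ) (hv : ∀ m, n < m → 0 ≤ v m) :
    R v n ≤ ∑ j ∈ range N, lam n j * (v (n + 1 + j) + R v (n + 1 + j)) := by
  have hv' : ∀ l, 0 ≤ v (n + 1 + l) := fun l => hv _ (by omega)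
  have h1 : R v n ≤ ∑ l ∈ range N, (lam n l + ∑ j ∈ range l, lam n j * K (n + 1 + j) (l - 1 - j)) * v (n + 1 + l) := by
    rw [hR v n]
    exact sum_le_sum fun l hl => mul_le_mul_of_nonneg_right (hent n l (mem_range.mp hl)) (hv' l)
  refine h1.trans ?_
  have h2 : ∑ l ∈ range N, (lam n l + ∑ j ∈ range l, lam n j * K (n + 1 + j) (l - 1 - j)) * v (n + 1 + l)
      = ∑ l ∈ range N, lam n l * v (n + 1 + l) + ∑ l ∈ range N, ∑ j ∈ range l, lam n j * K (n + 1 + j) (l - 1 - j) * v (n + 1 + l) := by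
    rw [← sum_add_distrib]; exact sum_congr rfl fun l _ => by rw [add_mul, sum_mul]
  have h3 : ∑ j ∈ range N, lam n j * (v (n + 1 + j) + R v (n + 1 + j))
      = ∑ j ∈ range N, lam n j * v (n + 1 + j) + ∑ j ∈ range N, lam n j * R v (n + 1 + j) := by
    rw [← sum_add_distrib]; exact sum_congr rfl fun j _ => by ring
  rw [h2, h3]
  refine add_le_add le_rfl ?_
  -- exchange the triangular double sum: `Σ_{l<N} Σ_{j<l} = Σ_{j<N} Σ_{l∈[j+1,N)}`
  rw [sum_comm' (t' := range N) (s' := fun j => Ico (j + 1) N) (fun l j =>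
    ⟨fun h => ⟨mem_Ico.mpr ⟨by have := mem_range.mp h.2; omega, mem_range.mp h.1⟩,
        mem_range.mpr (by have := mem_range.mp h.1; have := mem_range.mp h.2; omega)⟩,
     fun h => ⟨mem_range.mpr (mem_Ico.mp h.1).2, mem_range.mpr (by have := (mem_Ico.mp h.1).1; omega)⟩⟩)]
  refine sum_le_sum fun j hj => ?_
  rw [sum_Ico_eq_sum_range]
  calc ∑ l' ∈ range (N - (j + 1)), lam n j * K (n + 1 + j) (j + 1 + l' - 1 - j) * v (n + 1 + (j + 1 + l'))
      = lam n j * ∑ l' ∈ range (N - (j + 1)), K (n + 1 + j) l' * v (n + 1 + j + 1 + l') := by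
        rw [mul_sum]
        exact sum_congr rfl fun l' _ => by
          rw [show j + 1 + l' - 1 - j = l' by omega, show n + 1 + (j + 1 + l') = n + 1 + j + 1 + l' by ring]; ring
    _ ≤ lam n j * ∑ l' ∈ range N, K (n + 1 + j) l' * v (n + 1 + j + 1 + l') := by
        refine mul_le_mul_of_nonneg_left (sum_le_sum_of_subset_of_nonneg (range_mono (by omega)) fun l' _ _ => ?_) (hlam0 n j)
        exact mul_nonneg (hK _ _) (hv _ (by omega))
    _ = lam n j * R v (n + 1 + j) := by rw [hR v (n + 1 + j)]

/-! ## §2 The geometric weights and the criterion `Π_l (1 − r·K n l) ≥ 1 − r` -/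

/-- The geometric weights `λ_l = t_l·Π_{i<l}(1 − r t_i)` sum to `(1 − Π_{l<n}(1 − r t_l))∕r`: `r·Σ_{l<n} λ_l = 1 − Π_{l<n}(1 − r t_l)`. [folklore] -/
theorem geom_weights_sum (t : ℕ → ℝ) (r : ℝ) (n : ℕ) :
    r * ∑ j ∈ range n, t j * ∏ i ∈ range j, (1 - r * t i) = 1 - ∏ i ∈ range n, (1 - r * t i) := by
  induction n with
  | zero => simp
  | succ n ih => rw [sum_range_succ, mul_add, ih, prod_range_succ]; ring

/-- **THE GEOMETRIC WEIGHTS COVER THE ROW EXACTLY**: `λ_l + (Σ_{j<l} λ_j)·(r·t_l) = t_l`. [folklore] -/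
theorem geom_weights_cover (t : ℕ → ℝ) (r : ℝ) (l : ℕ) :
    t l * ∏ i ∈ range l, (1 - r * t i) + (∑ j ∈ range l, t j * ∏ i ∈ range j, (1 - r * t i)) * (r * t l) = t l := by
  have h := geom_weights_sum t r l
  have e : (∑ j ∈ range l, t j * ∏ i ∈ range j, (1 - r * t i)) * (r * t l) = t l * (1 - ∏ i ∈ range l, (1 - r * t i)) := by
    rw [← h]; ring
  rw [e]; ring

/-- **POSITIVITY BY THE GEOMETRIC COVER.**  Kernel `K ≥ 0` with reads `R`; a factor `0 < r` with `r·K n l ≤ 1`; DEEPER-ROW DOMINATION up to `r`: `r·K n l ≤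
K (n+1+j) (l−1−j)` for all `j < l < N`; and at every pin `1 − r ≤ Π_{l<N} (1 − r·K n l)`.  Then the zero-tailed solution of `t = w − R t` with `w ≥ 0` non-increasing
satisfies `0 ≤ t n ≤ w n` ((E113a) `sol_nonneg_le_of_cover` with the geometric weights, an entrywise cover by `geom_weights_cover` + domination, of total mass
`(1 − Π)∕r ≤ 1`). [folklore] -/
theorem sol_nonneg_le_of_geometric_cover (hR : ∀ v n, R v n = ∑ l ∈ range N, K n l * v (n + 1 + l)) (hK : ∀ n l, 0 ≤ K n l)
    {r : ℝ} (hr0 : 0 < r) (hrt : ∀ n l, r * K n l ≤ 1)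
    (hdom : ∀ n j l, j < l → l < N → r * K n l ≤ K (n + 1 + j) (l - 1 - j))
    (hprod : ∀ n, 1 - r ≤ ∏ l ∈ range N, (1 - r * K n l))
    {w t : ℕ → ℝ} (hw0 : ∀ n, 0 ≤ w n) (hanti : ∀ n, w (n + 1) ≤ w n)
    (htail : ∀ n, N < n → t n = 0) (hrec : ∀ n, t n = w n - R t n) : ∀ n, 0 ≤ t n ∧ t n ≤ w n := by
  have hlam0 : ∀ n j, 0 ≤ K n j * ∏ i ∈ range j, (1 - r * K n i) :=
    fun n j => mul_nonneg (hK n j) (prod_nonneg fun i _ => by linarith [hrt n i])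
  refine sol_nonneg_le_of_cover hR hK (lam := fun n l => K n l * ∏ i ∈ range l, (1 - r * K n i)) hlam0 (fun n => ?_) ?_ hw0 hanti htail hrec
  · -- total mass `(1 − Π)∕r ≤ 1`
    have h := geom_weights_sum (K n) r N
    by_contra hS
    rw [not_le] at hS
    have := mul_lt_mul_of_pos_left hS hr0
    linarith [hprod n]
  · refine cover_of_entrywise hR hK hlam0 (fun n l hl => ?_)
    have hcov := geom_weights_cover (K n) r l
    calc K n l = K n l * ∏ i ∈ range l, (1 - r * K n i)
          + (∑ j ∈ range l, K n j * ∏ i ∈ range j, (1 - r * K n i)) * (r * K n l) := hcov.symm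
      _ = K n l * ∏ i ∈ range l, (1 - r * K n i)
          + ∑ j ∈ range l, (K n j * ∏ i ∈ range j, (1 - r * K n i)) * (r * K n l) := by rw [sum_mul]
      _ ≤ K n l * ∏ i ∈ range l, (1 - r * K n i)
          + ∑ j ∈ range l, (K n j * ∏ i ∈ range j, (1 - r * K n i)) * K (n + 1 + j) (l - 1 - j) :=
          add_le_add le_rfl (sum_le_sum fun j hj => mul_le_mul_of_nonneg_left (hdom n j l (mem_range.mp hj) hl) (hlam0 n j))

/-- `r = 1`: **ROWS DOMINATED BY EVERY DEEPER ROW AT EVERY COMMON COLUMN** (`K n l ≤ K (n+1+j) (l−1−j)`, `j < l`) with entries `≤ 1` ⟹ `0 ≤ t ≤ w`, WHATEVER the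
row masses (the product criterion is void: `Π ≥ 0 = 1 − r`). [folklore] -/
theorem sol_nonneg_le_of_deeper_domination (hR : ∀ v n, R v n = ∑ l ∈ range N, K n l * v (n + 1 + l)) (hK : ∀ n l, 0 ≤ K n l)
    (hle : ∀ n l, K n l ≤ 1) (hdom : ∀ n j l, j < l → l < N → K n l ≤ K (n + 1 + j) (l - 1 - j))
    {w t : ℕ → ℝ} (hw0 : ∀ n, 0 ≤ w n) (hanti : ∀ n, w (n + 1) ≤ w n)
    (htail : ∀ n, N < n → t n = 0) (hrec : ∀ n, t n = w n - R t n) : ∀ n, 0 ≤ t n ∧ t n ≤ w n :=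
  sol_nonneg_le_of_geometric_cover hR hK one_pos (fun n l => by rw [one_mul]; exact hle n l)
    (fun n j l hj hl => by rw [one_mul]; exact hdom n j l hj hl)
    (fun n => by rw [sub_self]; exact prod_nonneg fun l _ => by linarith [hle n l]) hw0 hanti htail hrec

/-! ## §3 Sufficient conditions for the product criterion -/

/-- Weierstrass: `1 − Σ_{l<n} x_l ≤ Π_{l<n} (1 − x_l)` for `0 ≤ x_l ≤ 1` — so `Π ≥ 1 − r` holds as soon as `Σ_l K n l ≤ 1` (the light load is the limit `r → 0`).
[folklore] -/
theorem one_sub_sum_le_prod_one_sub {x : ℕ → ℝ} {n : ℕ} (hx : ∀ l, l < n → 0 ≤ x l ∧ x l ≤ 1) :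
    1 - ∑ l ∈ range n, x l ≤ ∏ l ∈ range n, (1 - x l) := by
  induction n with
  | zero => simp
  | succ n ih =>
    have hx' : ∀ l, l < n → 0 ≤ x l ∧ x l ≤ 1 := fun l hl => hx l (by omega)
    have hn := hx n (by omega)
    have hP : 0 ≤ ∏ l ∈ range n, (1 - x l) := prod_nonneg fun l hl => by linarith [(hx' l (mem_range.mp hl)).2]
    have hS : 0 ≤ ∑ l ∈ range n, x l := sum_nonneg fun l hl => (hx' l (mem_range.mp hl)).1
    rw [sum_range_succ, prod_range_succ]
    nlinarith [ih hx', hn.1, hn.2]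

/-- **`exp(−Σ_{l<n} x_l∕(1 − x_l)) ≤ Π_{l<n} (1 − x_l)`** for `0 ≤ x_l < 1` (termwise `exp(−x∕(1−x)) ≤ 1 − x`, which is
`Literature.NumberTheory.Sieve.exp_neg_div_le_one_sub` — imported, not restated). [folklore] -/
theorem exp_neg_sum_le_prod_one_sub {x : ℕ → ℝ} {n : ℕ} (hx : ∀ l, l < n → 0 ≤ x l ∧ x l < 1) :
    Real.exp (-∑ l ∈ range n, x l / (1 - x l)) ≤ ∏ l ∈ range n, (1 - x l) := by
  induction n with
  | zero => simp
  | succ n ih =>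
    have hx' : ∀ l, l < n → 0 ≤ x l ∧ x l < 1 := fun l hl => hx l (by omega)
    have hn := hx n (by omega)
    rw [sum_range_succ, prod_range_succ, neg_add, Real.exp_add]
    exact mul_le_mul (ih hx') (Literature.NumberTheory.Sieve.exp_neg_div_le_one_sub hn.2) (Real.exp_pos _).le
      (prod_nonneg fun l hl => by linarith [(hx' l (mem_range.mp hl)).2])

/-- **THE GEOMETRIC COVER, EXPONENTIAL FORM.**  As `sol_nonneg_le_of_geometric_cover`, with the product criterion replaced by
`Σ_{l<N} r·K n l∕(1 − r·K n l) ≤ −log(1 − r)` at every pin (`0 < r < 1`, `r·K n l < 1`) — for rows with small entries this is mass `≲ log(1∕(1−r))∕r`. [folklore] -/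
theorem sol_nonneg_le_of_geometric_cover_exp (hR : ∀ v n, R v n = ∑ l ∈ range N, K n l * v (n + 1 + l)) (hK : ∀ n l, 0 ≤ K n l)
    {r : ℝ} (hr0 : 0 < r) (hr1 : r < 1) (hrt : ∀ n l, r * K n l < 1)
    (hdom : ∀ n j l, j < l → l < N → r * K n l ≤ K (n + 1 + j) (l - 1 - j))
    (hsum : ∀ n, ∑ l ∈ range N, r * K n l / (1 - r * K n l) ≤ -Real.log (1 - r))
    {w t : ℕ → ℝ} (hw0 : ∀ n, 0 ≤ w n) (hanti : ∀ n, w (n + 1) ≤ w n)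
    (htail : ∀ n, N < n → t n = 0) (hrec : ∀ n, t n = w n - R t n) : ∀ n, 0 ≤ t n ∧ t n ≤ w n := by
  refine sol_nonneg_le_of_geometric_cover hR hK hr0 (fun n l => (hrt n l).le) hdom (fun n => ?_) hw0 hanti htail hrec
  have h1 : 0 < 1 - r := by linarith
  have hx : ∀ l, l < N → 0 ≤ r * K n l ∧ r * K n l < 1 := fun l _ => ⟨mul_nonneg hr0.le (hK n l), hrt n l⟩
  calc 1 - r = Real.exp (Real.log (1 - r)) := (Real.exp_log h1).symm
    _ ≤ Real.exp (-∑ l ∈ range N, r * K n l / (1 - r * K n l)) := Real.exp_le_exp.mpr (by linarith [hsum n])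
    _ ≤ ∏ l ∈ range N, (1 - r * K n l) := exp_neg_sum_le_prod_one_sub hx

end Summit.QuantumFields.BalabanUV.Beta.EriceRemainderEnclosureHistoryAutonomyComparisonAgeCompositionGeometricCover

end
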